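import Summits.RiemannHypothesis.RiemannHypothesis.Theorems.GroundBartaPolarPerronFrobeniusGapCertCore
import Summits.RiemannHypothesis.RiemannHypothesis.Theorems.GroundBartaEvenWinsBeyondArchDeflationCertBridgeWXA45
import Summits.RiemannHypothesis.RiemannHypothesis.Theorems.GroundBartaEvenWinsBeyondArchDeflationCutRitz
import HarnessLib

/-!
# Gap certificates from deflated Temple data, IIb: cut trial vectors and the three-zone bridge beyond `(log 5)/2`
(route `RiemannHypothesis/GroundBarta`, crux `PolarPerronFrobenius` = stmt-RiemannHypothesis-18390, helper; RH-free, no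
definitions, no named facts, no sorry)

The `{2,3,4,5}`-window (`(log 5)/2 < c ≤ (log 7)/2`, e.g. `c = 83/100`) counterpart of `GroundBartaPolarPerronFrobeniusGapCertBridge`:
prover A g11's three-zone bridge `dt_sector_bound_of_deflCert_wxa45` (certificate on `[-a₀, a₀]`, cut trial vectors
`𝟙_{[-c',c']} g_i`, extended images at `b`, leak `ν`, edge-only slivers of `4` and `5`) copied with the rank-one penalty
`K |Σ_l c_l ∫ φ v̄_l|²` carried through and the THREE complement levels scaled by `1 − θ`
(`nI = (1−θ)β'`, `nM = (1−θ)(β' − κ₄)`, `nE = (1−θ)(β' − κ₄ − κ₅)`, `β' = β₂₃ − 2ν`), so that every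
`λ ≤ θ (β' − κ₄ − κ₅)` is admissible with the `λ = 0` weights of a positivity cell divided by `1 − θ`.  This is the bridge
the `83/100` even block (`…N83EFinal` / `…N83ELastA`, nine Ritz vectors) needs for its gap certificate.

* `gc_sector_bound_of_cut_wK` — copy of `dt_sector_bound_of_cut_w` over `gc_sector_bound_wK`.
* `gc_sector_bound_of_deflCert_wxa45K` — copy of `dt_sector_bound_of_deflCert_wxa45`, conclusion
  `λ ∫|φ|² ≤ Re Q(φ) + K |Σ_l c_l ∫ φ v̄_l|²` for every parity-`σ` window test `φ` on `[-c, c]`.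

References: A. Weinstein, W. Stenger (1972) Ch. 5 §9; E. Bombieri, Rend. Mat. Acc. Lincei (9) 11 (2000) Thm 2, §4.
Prover B, speedrun unit `sr-gb-rung-b` (gen 17).
-/

set_option linter.dupNamespace false

noncomputable section

open MeasureTheory Set Filter
open scoped Topology ENNReal NNReal ComplexConjugate BigOperators

namespace Summit.RiemannHypothesis.RiemannHypothesis.Theorems.PolarPerronFrobenius

open Literature.NumberTheory.LFunctions Literature.NumberTheory.LFunctions.ConnesVanSuijlekom
open Summit.RiemannHypothesis.RiemannHypothesis.Theorems.EvenWinsBeyondArch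
open Summit.RiemannHypothesis.RiemannHypothesis.Theorems.OddSector (weilDirichletEnergy₂ weilPoleForm₂)

/-! ## Cut trial vectors -/

/-- **Penalised weighted deflated Temple bound from `C²` vectors cut inside the window** (copy of
`dt_sector_bound_of_cut_w` over `gc_sector_bound_wK`): `λ∫|φ|² ≤ Re Q(φ) + K |Σ_l c_l ∫ φ v̄_l|²` for every smooth `φ`
supported in `[-c, c]` with `φ(-x) = σφ(x)`. [cite: WeinsteinStenger1972, Ch. 5 §9 eq. (2) (k = 1: Temple's formula)] -/
theorem gc_sector_bound_of_cut_wK {c c' : ℝ} (hc' : 0 < c') (hcc : c' ≤ c) (σ : ℝ) {k : ℕ}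
    (g : Fin k → ℝ → ℝ) (hg : ∀ i, ContDiff ℝ 2 (g i)) (hgp : ∀ i x, g i (-x) = σ * g i x)
    (v F : Fin k → ℝ → ℂ) (hv : ∀ i x, v i x = (((Icc (-c') c').indicator (g i) x : ℝ) : ℂ))
    (hF : ∀ i y, F i y = (Icc (-c) c).indicator (fun y ↦
        2 * (∫ x, v i x * (Real.cosh (x / 2) : ℂ)) * (Real.cosh (y / 2) : ℂ) -
          2 * (∫ x, v i x * (Real.sinh (x / 2) : ℂ)) * (Real.sinh (y / 2) : ℂ) +
        (∑ n ∈ weilPrimeIndex c, (((ArithmeticFunction.vonMangoldt n : ℝ) / Real.sqrt n : ℝ) : ℂ) *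
          (2 * v i y - v i (y - Real.log n) - v i (y + Real.log n))) +
        ∫ t in Ioi 0, (weilArchDensity t : ℂ) * (2 * v i y - v i (y - t) - v i (y + t))) y -
      (weilMarkovConstant c : ℂ) * v i y)
    (W : Fin k → Fin k → ℝ) (μ : Fin k → ℝ) (lam : ℝ) (hμ : ∀ i, 0 ≤ μ i) (K : ℝ) (cv : Fin k → ℝ)
    {n w : ℝ → ℝ} (hnm : Measurable n) (hwm : Measurable w) {C : ℝ} (hnC : ∀ y, |n y| ≤ C) (hwC : ∀ y, |w y| ≤ C)
    (hn0 : ∀ y, 0 ≤ n y) (hw0 : ∀ y, 0 ≤ w y) (hwn : ∀ y, w y * n y = 1)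
    (hcert : ∀ φ : ℝ → ℂ, IsWeilTest φ → tsupport φ ⊆ Icc (-c) c → (∀ x, φ (-x) = (σ : ℂ) * φ x) →
      (∫ y, n y * ‖φ y‖ ^ 2) + lam * ∫ x, ‖φ x‖ ^ 2 ≤
        (weilQuadratic φ).re + ∑ i, μ i * ‖∫ x, φ x * conj (v i x)‖ ^ 2)
    (hPSD : ∀ α : Fin k → ℝ, 0 ≤ ∑ i, ∑ j, α i * α j *
      ((weilPoleForm₂ (v i) (v j) + weilDirichletEnergy₂ c (v i) (v j) -
          weilMarkovConstant c * ∫ x, (v i x * conj (v j x)).re) - lam * (∫ x, (v i x * conj (v j x)).re) -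
        (∫ y, w y * ((F i - ∑ l, W i l • v l) y * conj ((F j - ∑ l, W j l • v l) y)).re) +
        K * ((∑ l, cv l * ∫ x, (v l x * conj (v i x)).re) * (∑ l, cv l * ∫ x, (v l x * conj (v j x)).re))))
    {φ : ℝ → ℂ} (hφ : IsWeilTest φ) (hφs : tsupport φ ⊆ Icc (-c) c) (hφp : ∀ x, φ (-x) = (σ : ℂ) * φ x) :
    lam * ∫ x, ‖φ x‖ ^ 2 ≤ (weilQuadratic φ).re + K * ‖∑ l, (cv l : ℂ) * ∫ x, φ x * conj (v l x)‖ ^ 2 := by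
  -- adapted from EvenWinsBeyondArch.dt_sector_bound_of_cut_w
  have hc : 0 < c := lt_of_lt_of_le hc' hcc
  have hvD : ∀ i, MemLp (v i) 2 ∧ (∀ x, x ∉ Icc (-c) c → v i x = 0) ∧ (∀ x, (v i x).im = 0) ∧
      (∀ x, v i (-x) = (σ : ℂ) * v i x) ∧
      IntegrableOn (fun t ↦ weilArchDensity t * weilIncrement (v i) t) (Ioi 0) := fun i ↦
    dt_cut_mem_formDomain hc' hcc σ ((hg i).of_le (by norm_num)) (hgp i) (hv i)
  have hmaj : ∀ i, ∃ m : ℝ → ℝ, MemLp m 2 volume ∧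
      (∀ᵐ y : ℝ, y ∈ Ioo (-c) c →
        IntegrableOn (fun t ↦ weilArchDensity t * ‖2 * v i y - v i (y - t) - v i (y + t)‖) (Ioi 0) ∧
          ∫ t in Ioi 0, weilArchDensity t * ‖2 * v i y - v i (y - t) - v i (y + t)‖ ≤ m y) :=
    fun i ↦ dt_exists_majorant_of_contDiff_cut hc' hcc (hg i) (hv i)
  have hFm : ∀ i, MemLp (F i) 2 := by
    intro i
    obtain ⟨m, hm, hH⟩ := hmaj i
    exact dt_windowImage_memLp_ae (hvD i).1 hm hH (hF i)
  have hrepr : ∀ i (f : ℝ → ℂ), MemLp f 2 → (∀ x, x ∉ Icc (-c) c → f x = 0) → (∀ x, (f x).im = 0) →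
      (∀ x, f (-x) = (σ : ℂ) * f x) →
      IntegrableOn (fun t ↦ weilArchDensity t * weilIncrement f t) (Ioi 0) →
      weilPoleForm₂ (v i) f + weilDirichletEnergy₂ c (v i) f -
          weilMarkovConstant c * ∫ x, (v i x * conj (f x)).re = ∫ x, (F i x * conj (f x)).re := by
    intro i f hf hfs _ _ _
    obtain ⟨m, hm, hH⟩ := hmaj i
    exact dt_windowImage_repr_ae (hvD i).1 hm hH (hF i) hf hfs
  exact gc_sector_bound_wK hc σ v F W μ lam hμ K cv hnm hwm hnC hwC hn0 hw0 hwn hvD hFm hrepr hcert hPSD hφ hφs hφp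

/-! ## The three-zone bridge with penalty and scaled complement levels -/

set_option maxHeartbeats 400000 in
/-- **Gap certificate in deflation shape from a three-zone (`{2,3,4,5}`-window) certificate, parity `σ`** (copy of
`dt_sector_bound_of_deflCert_wxa45`).  Setting as there (`log 2 < c' ≤ c ≤ (log 7)/2`, `c ≤ b`, `c ≤ a₀`, same prime band
for `c'` and `c`, certificate `hcert23` at level `β₂₃`, trial vectors `𝟙_{[-c',c']} g_i`, extended images `Fx_i` at `b`,
leak `ν`, `κ₄ ≥ (log 2)/2`, `κ₅ ≥ log 5/√5`, thresholds `y₄ ≤ log 4 − c`, `y₅ ≤ log 5 − c`, `y₄ ≤ y₅`), plus: `0 ≤ θ < 1`,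
`λ ≤ θ (β₂₃ − 2ν − κ₄ − κ₅)` with `β₂₃ − 2ν − κ₄ − κ₅ > 0`, a real `K`, coefficients `c_l`, and the penalised weighted
datum with the three weights `1/((1−θ)(β' − κ₄ − κ₅))`, `1/((1−θ)(β' − κ₄))`, `1/((1−θ)β')` (`β' = β₂₃ − 2ν`).
Conclusion: `λ ∫|φ|² ≤ Re Q(φ) + K |Σ_l c_l ∫ φ v̄_l|²` for every parity-`σ` window test `φ` on `[-c, c]`. [folklore] -/
theorem gc_sector_bound_of_deflCert_wxa45K {c c' b a₀ : ℝ} (hc'2 : Real.log 2 < c') (hcc : c' ≤ c)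
    (hc7 : c ≤ Real.log 7 / 2) (hcb : c ≤ b) (hca : c ≤ a₀)
    (hPI : weilPrimeIndex c = weilPrimeIndex c') (hM : weilMarkovConstant c = weilMarkovConstant c')
    (hE₂ : ∀ f h, weilDirichletEnergy₂ c f h = weilDirichletEnergy₂ c' f h) (σ : ℝ)
    (R : List (ℚ × ℕ × List ℚ)) (n : ℕ) {β₂₃ : ℝ}
    (g : Fin R.length → ℝ → ℝ) (hg : ∀ i, ContDiff ℝ 2 (g i)) (hgp : ∀ i x, g i (-x) = σ * g i x)
    (hRμ : ∀ i : Fin R.length, 0 ≤ (R.get i).1)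
    (hcert23 : ∀ g : ℝ → ℂ, IsWeilTest g → tsupport g ⊆ Icc (-a₀) a₀ → (∀ x, g (-x) = (σ : ℂ) * g x) →
      β₂₃ * weilNorm2Sq g ≤ weilTwoPrimeQuadratic g +
        (R.map fun r ↦ (r.1 : ℝ) * ‖∑ k ∈ Finset.range n, ((maskV r k : ℚ) : ℂ) * weilMoment a₀ g k‖ ^ 2).sum)
    (v Fx : Fin R.length → ℝ → ℂ)
    (hv : ∀ i x, v i x = (((Icc (-c') c').indicator (g i) x : ℝ) : ℂ))
    (hFx : ∀ i y, Fx i y = (Icc (-b) b).indicator (fun y ↦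
        2 * (∫ x, v i x * (Real.cosh (x / 2) : ℂ)) * (Real.cosh (y / 2) : ℂ) -
          2 * (∫ x, v i x * (Real.sinh (x / 2) : ℂ)) * (Real.sinh (y / 2) : ℂ) +
        (∑ m ∈ weilPrimeIndex c', (((ArithmeticFunction.vonMangoldt m : ℝ) / Real.sqrt m : ℝ) : ℂ) *
          (2 * v i y - v i (y - Real.log m) - v i (y + Real.log m))) +
        ∫ t in Ioi 0, (weilArchDensity t : ℂ) * (2 * v i y - v i (y - t) - v i (y + t))) y -
      (weilMarkovConstant c' : ℂ) * v i y)
    (W : Fin R.length → Fin R.length → ℝ) {κ₄ κ₅ : ℝ} (hκ₄ : Real.log 2 / 2 ≤ κ₄)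
    (hκ₅ : Real.log 5 / Real.sqrt 5 ≤ κ₅)
    {ν : ℝ} (hν : ∑ i : Fin R.length, ((R.get i).1 : ℝ) *
      ((∫ x in Icc (-c') c', (maskPoly (R.get i) n a₀ x - g i x) ^ 2) +
        ∫ x in Icc (-a₀) a₀ \ Icc (-c') c', (maskPoly (R.get i) n a₀ x) ^ 2) ≤ ν)
    (hpos : 0 < β₂₃ - 2 * ν - κ₄ - κ₅) {θ : ℝ} (hθ : 0 ≤ θ) (hθ1 : θ < 1)
    {lam : ℝ} (hlam : lam ≤ θ * (β₂₃ - 2 * ν - κ₄ - κ₅)) {y₄ y₅ : ℝ} (hy₄ : y₄ ≤ Real.log 4 - c)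
    (hy₅ : y₅ ≤ Real.log 5 - c) (hy45 : y₄ ≤ y₅) (K : ℝ) (cv : Fin R.length → ℝ)
    (hPSD : ∀ α : Fin R.length → ℝ, 0 ≤ ∑ i, ∑ j, α i * α j *
      ((weilPoleForm₂ (v i) (v j) + weilDirichletEnergy₂ c' (v i) (v j) -
          weilMarkovConstant c' * ∫ x, (v i x * conj (v j x)).re) - lam * (∫ x, (v i x * conj (v j x)).re) -
        (∫ y, {u : ℝ | y₅ ≤ |u|}.piecewise (fun _ ↦ 1 / ((1 - θ) * (β₂₃ - 2 * ν - κ₄ - κ₅)))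
            ({u : ℝ | y₄ ≤ |u|}.piecewise (fun _ ↦ 1 / ((1 - θ) * (β₂₃ - 2 * ν - κ₄)))
              (fun _ ↦ 1 / ((1 - θ) * (β₂₃ - 2 * ν)))) y *
          ((Fx i - ∑ l, W i l • v l) y * conj ((Fx j - ∑ l, W j l • v l) y)).re) +
        K * ((∑ l, cv l * ∫ x, (v l x * conj (v i x)).re) * (∑ l, cv l * ∫ x, (v l x * conj (v j x)).re))))
    {φ : ℝ → ℂ} (hφ : IsWeilTest φ) (hφs : tsupport φ ⊆ Icc (-c) c) (hφp : ∀ x, φ (-x) = (σ : ℂ) * φ x) :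
    lam * ∫ x, ‖φ x‖ ^ 2 ≤ (weilQuadratic φ).re + K * ‖∑ l, (cv l : ℂ) * ∫ x, φ x * conj (v l x)‖ ^ 2 := by
  -- adapted from EvenWinsBeyondArch.dt_sector_bound_of_deflCert_wxa45 (levels scaled by 1 − θ, penalty K)
  have hlog2 : 0 < Real.log 2 := Real.log_pos (by norm_num)
  have hc' : 0 < c' := hlog2.trans hc'2
  have hcb' : c' ≤ b := hcc.trans hcb
  have h1θ : 0 < 1 - θ := by linarith
  set E₄ : Set ℝ := {u : ℝ | y₄ ≤ |u|} with hE₄def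
  set E₅ : Set ℝ := {u : ℝ | y₅ ≤ |u|} with hE₅def
  have hE₄ : MeasurableSet E₄ := measurableSet_le measurable_const continuous_abs.measurable
  have hE₅ : MeasurableSet E₅ := measurableSet_le measurable_const continuous_abs.measurable
  have h54 : E₅ ⊆ E₄ := fun u (hu : y₅ ≤ |u|) ↦ show y₄ ≤ |u| from hy45.trans hu
  set F : Fin R.length → ℝ → ℂ := fun i y ↦ (Icc (-c) c).indicator (fun y ↦
        2 * (∫ x, v i x * (Real.cosh (x / 2) : ℂ)) * (Real.cosh (y / 2) : ℂ) -
          2 * (∫ x, v i x * (Real.sinh (x / 2) : ℂ)) * (Real.sinh (y / 2) : ℂ) +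
        (∑ m ∈ weilPrimeIndex c, (((ArithmeticFunction.vonMangoldt m : ℝ) / Real.sqrt m : ℝ) : ℂ) *
          (2 * v i y - v i (y - Real.log m) - v i (y + Real.log m))) +
        ∫ t in Ioi 0, (weilArchDensity t : ℂ) * (2 * v i y - v i (y - t) - v i (y + t))) y -
      (weilMarkovConstant c : ℂ) * v i y with hFdef
  have hpc : ∀ i, ContDiff ℝ 2 (g i) := hg
  have hvM : ∀ i, MemLp (v i) 2 := fun i ↦ (dt_cut_mem_formDomain hc' hcc σ ((hpc i).of_le (by norm_num))
    (hgp i) (hv i)).1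
  have hvout : ∀ i y, y ∉ Icc (-c') c' → v i y = 0 := fun i y hy ↦ by rw [hv i y, indicator_of_notMem hy]; simp
  -- the three (scaled) levels
  set nI : ℝ := (1 - θ) * (β₂₃ - 2 * ν) with hnI
  set nM : ℝ := (1 - θ) * (β₂₃ - 2 * ν - κ₄) with hnM
  set nE : ℝ := (1 - θ) * (β₂₃ - 2 * ν - κ₄ - κ₅) with hnE
  have hκ₄0 : 0 ≤ κ₄ := le_trans (by positivity) hκ₄
  have hκ₅0 : 0 ≤ κ₅ := le_trans (by positivity) hκ₅
  have hnE0 : 0 < nE := by rw [hnE]; exact mul_pos h1θ hpos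
  have hnM0 : 0 < nM := by rw [hnM]; exact mul_pos h1θ (by linarith)
  have hnI0 : 0 < nI := by rw [hnI]; exact mul_pos h1θ (by linarith)
  have hnEM : nE ≤ nM := by rw [hnE, hnM]; nlinarith
  have hnMI : nM ≤ nI := by rw [hnM, hnI]; nlinarith
  set C : ℝ := nI + 1 / nE with hC
  set nf : ℝ → ℝ := E₅.piecewise (fun _ ↦ nE) (E₄.piecewise (fun _ ↦ nM) (fun _ ↦ nI)) with hnfdef
  set w : ℝ → ℝ := E₅.piecewise (fun _ ↦ 1 / nE) (E₄.piecewise (fun _ ↦ 1 / nM) (fun _ ↦ 1 / nI)) with hwdef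
  have hcase : ∀ y, (nf y = nE ∧ w y = 1 / nE) ∨ (nf y = nM ∧ w y = 1 / nM) ∨ (nf y = nI ∧ w y = 1 / nI) := by
    intro y
    by_cases h5 : y ∈ E₅
    · exact Or.inl ⟨Set.piecewise_eq_of_mem _ _ _ h5, Set.piecewise_eq_of_mem _ _ _ h5⟩
    · by_cases h4 : y ∈ E₄
      · refine Or.inr (Or.inl ⟨?_, ?_⟩)
        · rw [hnfdef, Set.piecewise_eq_of_notMem _ _ _ h5, Set.piecewise_eq_of_mem _ _ _ h4]
        · rw [hwdef, Set.piecewise_eq_of_notMem _ _ _ h5, Set.piecewise_eq_of_mem _ _ _ h4]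
      · refine Or.inr (Or.inr ⟨?_, ?_⟩)
        · rw [hnfdef, Set.piecewise_eq_of_notMem _ _ _ h5, Set.piecewise_eq_of_notMem _ _ _ h4]
        · rw [hwdef, Set.piecewise_eq_of_notMem _ _ _ h5, Set.piecewise_eq_of_notMem _ _ _ h4]
  have hmeas3 : ∀ a₁ a₂ a₃ : ℝ,
      Measurable (E₅.piecewise (fun _ ↦ a₁) (E₄.piecewise (fun _ ↦ a₂) (fun _ ↦ a₃))) := fun a₁ a₂ a₃ ↦
    Measurable.piecewise hE₅ measurable_const (Measurable.piecewise hE₄ measurable_const measurable_const)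
  have hnfm : Measurable nf := hmeas3 _ _ _
  have hwm : Measurable w := hmeas3 _ _ _
  have h1E : 1 / nI ≤ 1 / nE := one_div_le_one_div_of_le hnE0 (hnEM.trans hnMI)
  have h1M : 1 / nM ≤ 1 / nE := one_div_le_one_div_of_le hnE0 hnEM
  have hwC : ∀ y, |w y| ≤ C := by
    intro y
    rcases hcase y with ⟨_, h⟩ | ⟨_, h⟩ | ⟨_, h⟩ <;> rw [h, abs_of_pos (by positivity), hC] <;>
      linarith [hnI0.le]
  have hw0 : ∀ y, 0 ≤ w y := by
    intro y; rcases hcase y with ⟨_, h⟩ | ⟨_, h⟩ | ⟨_, h⟩ <;> rw [h] <;> positivity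
  have hnC : ∀ y, |nf y| ≤ C := by
    intro y
    have h1 : 0 ≤ 1 / nE := by positivity
    rcases hcase y with ⟨h, _⟩ | ⟨h, _⟩ | ⟨h, _⟩ <;> rw [h]
    · rw [abs_of_pos hnE0, hC]; linarith
    · rw [abs_of_pos hnM0, hC]; linarith
    · rw [abs_of_pos hnI0, hC]; linarith
  have hn0 : ∀ y, 0 ≤ nf y := by
    intro y; rcases hcase y with ⟨h, _⟩ | ⟨h, _⟩ | ⟨h, _⟩ <;> rw [h] <;> positivity
  have hwn : ∀ y, w y * nf y = 1 := by
    intro y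
    rcases hcase y with ⟨h, h'⟩ | ⟨h, h'⟩ | ⟨h, h'⟩ <;> rw [h, h'] <;> field_simp
  -- the penalised PSD datum at the window `c`
  have hPSD' : ∀ α : Fin R.length → ℝ, 0 ≤ ∑ i, ∑ j, α i * α j *
      ((weilPoleForm₂ (v i) (v j) + weilDirichletEnergy₂ c (v i) (v j) -
          weilMarkovConstant c * ∫ x, (v i x * conj (v j x)).re) - lam * (∫ x, (v i x * conj (v j x)).re) -
        (∫ y, w y * ((F i - ∑ l, W i l • v l) y * conj ((F j - ∑ l, W j l • v l) y)).re) +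
        K * ((∑ l, cv l * ∫ x, (v l x * conj (v i x)).re) * (∑ l, cv l * ∫ x, (v l x * conj (v j x)).re))) := by
    have hr : ∀ i, MemLp (F i - ∑ l, W i l • v l) 2 := by
      intro i
      obtain ⟨m, hm, hH⟩ := dt_exists_majorant_of_contDiff_cut hc' hcc (hpc i) (hv i)
      exact (dt_windowImage_memLp_ae (hvM i) hm hH (fun y ↦ by rw [hFdef])).sub
        (memLp_finsetSum' _ fun l _ ↦ (hvM l).const_smul _)
    have hrx : ∀ i, MemLp (Fx i - ∑ l, W i l • v l) 2 := by
      intro i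
      obtain ⟨m, hm, hH⟩ := dt_exists_majorant_of_contDiff_cut hc' hcb' (hpc i) (hv i)
      exact (dt_windowImageX_memLp (hvM i) hm hH (weilPrimeIndex c') (weilMarkovConstant c') (hFx i)).sub
        (memLp_finsetSum' _ fun l _ ↦ (hvM l).const_smul _)
    have hdom : ∀ y, (∀ i, (F i - ∑ l, W i l • v l) y = (Fx i - ∑ l, W i l • v l) y) ∨
        (∀ i, (F i - ∑ l, W i l • v l) y = 0) := by
      intro y
      by_cases hy' : y ∈ Icc (-c) c
      · refine Or.inl fun i ↦ ?_
        have hyb : y ∈ Icc (-b) b := Icc_subset_Icc (by linarith) hcb hy'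
        simp only [Pi.sub_apply, hFdef, hFx i y, indicator_of_mem hy', indicator_of_mem hyb, hPI, hM]
      · refine Or.inr fun i ↦ ?_
        have hvy : ∀ l, v l y = 0 := fun l ↦ hvout l y fun h ↦ hy' (Icc_subset_Icc (by linarith) hcc h)
        simp only [Pi.sub_apply, Finset.sum_apply, Pi.smul_apply, hFdef, indicator_of_notMem hy', hvy, smul_zero,
          Finset.sum_const_zero, mul_zero, sub_zero]
    intro α
    have h := dt_hPSD_of_dominated
      (fun i j ↦ (weilPoleForm₂ (v i) (v j) + weilDirichletEnergy₂ c' (v i) (v j) -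
          weilMarkovConstant c' * ∫ x, (v i x * conj (v j x)).re) - lam * (∫ x, (v i x * conj (v j x)).re) +
        K * ((∑ l, cv l * ∫ x, (v l x * conj (v i x)).re) * (∑ l, cv l * ∫ x, (v l x * conj (v j x)).re)))
      hwm hwC hw0 (fun i ↦ F i - ∑ l, W i l • v l) (fun i ↦ Fx i - ∑ l, W i l • v l) hr hrx hdom
      (fun α ↦ by
        have h0 := hPSD α
        have e : ∀ i j, (weilPoleForm₂ (v i) (v j) + weilDirichletEnergy₂ c' (v i) (v j) -
              weilMarkovConstant c' * ∫ x, (v i x * conj (v j x)).re) - lam * (∫ x, (v i x * conj (v j x)).re) -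
            (∫ y, w y * ((Fx i - ∑ l, W i l • v l) y * conj ((Fx j - ∑ l, W j l • v l) y)).re) +
            K * ((∑ l, cv l * ∫ x, (v l x * conj (v i x)).re) * (∑ l, cv l * ∫ x, (v l x * conj (v j x)).re)) =
            (weilPoleForm₂ (v i) (v j) + weilDirichletEnergy₂ c' (v i) (v j) -
              weilMarkovConstant c' * ∫ x, (v i x * conj (v j x)).re) - lam * (∫ x, (v i x * conj (v j x)).re) +
            K * ((∑ l, cv l * ∫ x, (v l x * conj (v i x)).re) * (∑ l, cv l * ∫ x, (v l x * conj (v j x)).re)) -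
            (∫ y, w y * ((Fx i - ∑ l, W i l • v l) y * conj ((Fx j - ∑ l, W j l • v l) y)).re) := by
          intro i j; ring
        simp only [hwdef, hnE, hnM, hnI] at h0 e ⊢
        simpa only [e] using h0) α
    have e2 : ∀ i j, (weilPoleForm₂ (v i) (v j) + weilDirichletEnergy₂ c' (v i) (v j) -
          weilMarkovConstant c' * ∫ x, (v i x * conj (v j x)).re) - lam * (∫ x, (v i x * conj (v j x)).re) +
        K * ((∑ l, cv l * ∫ x, (v l x * conj (v i x)).re) * (∑ l, cv l * ∫ x, (v l x * conj (v j x)).re)) -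
        (∫ y, w y * ((F i - ∑ l, W i l • v l) y * conj ((F j - ∑ l, W j l • v l) y)).re) =
        (weilPoleForm₂ (v i) (v j) + weilDirichletEnergy₂ c (v i) (v j) -
          weilMarkovConstant c * ∫ x, (v i x * conj (v j x)).re) - lam * (∫ x, (v i x * conj (v j x)).re) -
        (∫ y, w y * ((F i - ∑ l, W i l • v l) y * conj ((F j - ∑ l, W j l • v l) y)).re) +
        K * ((∑ l, cv l * ∫ x, (v l x * conj (v i x)).re) * (∑ l, cv l * ∫ x, (v l x * conj (v j x)).re)) := by
      intro i j; rw [hE₂, hM]; ring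
    simpa only [e2] using h
  refine gc_sector_bound_of_cut_wK hc' hcc σ g hpc hgp v F hv
    (fun i y ↦ by rw [hFdef]) W (fun i ↦ 2 * ((R.get i).1 : ℝ)) lam
    (fun i ↦ mul_nonneg zero_le_two (by exact_mod_cast hRμ i)) K cv
    (n := nf) (w := w) (C := C) hnfm hwm hnC hwC hn0 hw0 hwn ?_ hPSD' hφ hφs hφp
  -- the leaky three-zone certificate on smooth parity-σ tests, scaled levels
  intro ψ hψ hψs hψp
  have hψa : tsupport ψ ⊆ Icc (-a₀) a₀ := hψs.trans (Icc_subset_Icc (by linarith) hca)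
  have h23 := hcert23 ψ hψ hψa hψp
  have hleak := dt_cert_leak_approx R n hcc hca hRμ hψ hψs h23 g (fun i ↦ (hg i).continuous) v hv hν
  have hsl := dt_weilTwoPrimeQuadratic_sub_edges45_le_weilQuadratic_re hψ hψs hc7 hy₄ hy₅
  have h2 : Integrable fun u : ℝ ↦ ‖ψ u‖ ^ 2 := hψ.integrable_norm_sq
  have hn_int : (∫ y, nf y * ‖ψ y‖ ^ 2) =
      nI * (∫ y, ‖ψ y‖ ^ 2) + (nM - nI) * (∫ y, E₄.indicator (fun u ↦ ‖ψ u‖ ^ 2) y) +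
        (nE - nM) * ∫ y, E₅.indicator (fun u ↦ ‖ψ u‖ ^ 2) y := by
    rw [hnfdef]
    exact dt_integral_piecewise3_mul hE₄ hE₅ h54 nE nM nI h2
  have hMI : nM - nI = -((1 - θ) * κ₄) := by rw [hnM, hnI]; ring
  have hEM : nE - nM = -((1 - θ) * κ₅) := by rw [hnE, hnM]; ring
  rw [hn_int, hMI, hEM, hnI]
  have hX4 : 0 ≤ ∫ y, E₄.indicator (fun u ↦ ‖ψ u‖ ^ 2) y :=
    integral_nonneg fun y ↦ Set.indicator_nonneg (fun _ _ ↦ by positivity) y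
  have hX5 : 0 ≤ ∫ y, E₅.indicator (fun u ↦ ‖ψ u‖ ^ 2) y :=
    integral_nonneg fun y ↦ Set.indicator_nonneg (fun _ _ ↦ by positivity) y
  have hN0 : 0 ≤ ∫ y, ‖ψ y‖ ^ 2 := integral_nonneg fun y ↦ by positivity
  have hX4N : (∫ y, E₄.indicator (fun u ↦ ‖ψ u‖ ^ 2) y) ≤ ∫ y, ‖ψ y‖ ^ 2 :=
    integral_mono (h2.indicator hE₄) h2 fun y ↦ Set.indicator_le_self' (fun _ _ ↦ by positivity) y
  have hX5N : (∫ y, E₅.indicator (fun u ↦ ‖ψ u‖ ^ 2) y) ≤ ∫ y, ‖ψ y‖ ^ 2 :=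
    integral_mono (h2.indicator hE₅) h2 fun y ↦ Set.indicator_le_self' (fun _ _ ↦ by positivity) y
  have hκX4 := mul_le_mul_of_nonneg_right hκ₄ hX4
  have hκX5 := mul_le_mul_of_nonneg_right hκ₅ hX5
  have hws : weilNorm2Sq ψ = ∫ x, ‖ψ x‖ ^ 2 := rfl
  rw [hws] at h23
  have hlamN : lam * (∫ y, ‖ψ y‖ ^ 2) ≤ θ * (β₂₃ - 2 * ν - κ₄ - κ₅) * ∫ y, ‖ψ y‖ ^ 2 :=
    mul_le_mul_of_nonneg_right hlam hN0
  have hθ4 : θ * κ₄ * (∫ y, E₄.indicator (fun u ↦ ‖ψ u‖ ^ 2) y) ≤ θ * κ₄ * ∫ y, ‖ψ y‖ ^ 2 :=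
    mul_le_mul_of_nonneg_left hX4N (mul_nonneg hθ hκ₄0)
  have hθ5 : θ * κ₅ * (∫ y, E₅.indicator (fun u ↦ ‖ψ u‖ ^ 2) y) ≤ θ * κ₅ * ∫ y, ‖ψ y‖ ^ 2 :=
    mul_le_mul_of_nonneg_left hX5N (mul_nonneg hθ hκ₅0)
  -- scaled left side ≤ unscaled left side
  have key : (1 - θ) * (β₂₃ - 2 * ν) * (∫ y, ‖ψ y‖ ^ 2) +
        -((1 - θ) * κ₄) * (∫ y, E₄.indicator (fun u ↦ ‖ψ u‖ ^ 2) y) +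
        -((1 - θ) * κ₅) * (∫ y, E₅.indicator (fun u ↦ ‖ψ u‖ ^ 2) y) + lam * (∫ y, ‖ψ y‖ ^ 2) ≤
      (β₂₃ - 2 * ν) * (∫ y, ‖ψ y‖ ^ 2) + -κ₄ * (∫ y, E₄.indicator (fun u ↦ ‖ψ u‖ ^ 2) y) +
        -κ₅ * (∫ y, E₅.indicator (fun u ↦ ‖ψ u‖ ^ 2) y) := by
    linarith [hlamN, hθ4, hθ5]
  refine key.trans ?_
  -- the unscaled three-zone inequality (verbatim from `dt_sector_bound_of_deflCert_wxa45`)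
  nlinarith [hleak, hsl, hκX4, hκX5, hX4, hX5]

end Summit.RiemannHypothesis.RiemannHypothesis.Theorems.PolarPerronFrobenius

end
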